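import Mathlib
import Summits.Ventures.HodgeRepro2.T5LocalRingGaussSum

/-!
# T5HaarCosetAverage — a function constant on the cosets of a finite-index subgroup integrates, against
a left-invariant probability measure, to its average over the quotient; Kudla's Gauss-sum INTEGRAL is the
finite Gauss SUM

Kernel support for Tier 5, sub-step N5 / §G, reading residual [R-4] («Tate half»; route/T5-CHECK-G-p7.md §4,
§16.2 row P1.10; route/LEAN-ANNEX-p7.md §2q «stays prose»). `T5LocalRingGaussSum` and its companions prove the
identity `𝔤(χ)·𝔤(χ⁻¹) = χ(−1)` for the FINITE Gauss sum `gaussSum χ ψ = Σ_{ȳ ∈ 𝒪/𝔭^n} χ(ȳ)ψ(ȳ)`; Kudla's `𝔤(ω, ψ)`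
is printed as an INTEGRAL `q^{(ν+c)/2} ∫_{𝒪^×} ω^{-1}(y) ψ(ϖ^{-ν-c} y) dy` over the units of `𝒪_v` against the
additive Haar measure of `𝒪_v` with `vol(𝒪_v) = 1`. The integrand is constant on the cosets `y + 𝔭^c` (both
`ω^{-1}` — of conductor `𝔭^c` — and `ψ(ϖ^{-c}·)` — for `ψ` of conductor `𝒪` — factor through `𝒪/𝔭^c`), and a
character of `𝒪/𝔭^c` vanishing on the non-units is exactly the indicator of `𝒪^×` times a function of `ȳ`. So the
integral is the finite sum divided by `|𝒪/𝔭^c| = q^c`, and `q^{c/2}` times it is `gNorm = q^{-c/2}·gaussSum`: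

* `integral_comp_mk`: for an additive group `A` with a left-invariant probability measure `μ` and a measurable
  subgroup `N` of finite index, `∫ f̄(x mod N) dμ = |A/N|⁻¹ · Σ_{c ∈ A/N} f̄(c)` (`measure_addSubgroup_eq_inv_card`:
  `μ(N) = |A/N|⁻¹`, every coset has measure `μ(N)` by left invariance);
* `integral_comp_quotientMk`: the same for the quotient ring `𝒪 ⧸ I` by an ideal `I` of finite index;
* **`integral_mulChar_mul_addChar`**: `∫_𝒪 χ(π y) ψ(π y) dμ = |𝒪/I|⁻¹ · gaussSum χ ψ`, and
  `setIntegral_units_eq_integral`: the integral may be taken over `{y ∣ π y ∈ (𝒪/I)^×}` (the integrand vanishes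
  off the units);
* **`sqrt_card_mul_integral_eq_gNorm`**: `√|𝒪/I| · ∫_𝒪 χ(π y) ψ(π y) dμ = gNorm χ ψ` — Kudla's `𝔤` (the case
  `ν = 0` of his normalisation, `ψ` of conductor `𝒪`) IS the normalised finite Gauss sum of `T5LocalRingGaussSum`.

No topology is used: the measure is any left-invariant probability measure for which addition by constants is
measurable (`MeasurableAdd`), and `N` is assumed measurable. Nothing about local fields is defined.
-/

namespace Summit.Ventures.HodgeRepro2.T5HaarCosetAverage

open MeasureTheory Finset
open Summit.Ventures.HodgeRepro2.T5LocalRingGaussSum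

/-! ### Cosets of a finite-index subgroup all have the measure of the subgroup -/

section AddGroup

variable {A : Type*} [AddGroup A] [MeasurableSpace A] [MeasurableAdd A] (μ : Measure A)
  [μ.IsAddLeftInvariant] (N : AddSubgroup A)

omit [MeasurableSpace A] [MeasurableAdd A] [μ.IsAddLeftInvariant] in
/-- The fibre of `A → A ⧸ N` over the class of `g` is the preimage of `N` under `x ↦ -g + x`. -/
theorem preimage_mk_singleton (g : A) :
    (QuotientAddGroup.mk : A → A ⧸ N) ⁻¹' {(QuotientAddGroup.mk g : A ⧸ N)}
      = (fun x => -g + x) ⁻¹' (N : Set A) := by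
  ext x
  simp only [Set.mem_preimage, Set.mem_singleton_iff, SetLike.mem_coe]
  rw [eq_comm]
  exact QuotientAddGroup.eq

omit [μ.IsAddLeftInvariant] in
/-- The fibres of `A → A ⧸ N` are measurable when `N` is. -/
theorem measurableSet_fiber (hN : MeasurableSet (N : Set A)) (c : A ⧸ N) :
    MeasurableSet ((QuotientAddGroup.mk : A → A ⧸ N) ⁻¹' {c}) := by
  obtain ⟨g, rfl⟩ := QuotientAddGroup.mk_surjective c
  rw [preimage_mk_singleton]
  exact hN.preimage (measurable_const_add (-g))

/-- Every coset of `N` has the measure of `N` (left invariance). -/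
theorem measure_fiber (c : A ⧸ N) : μ ((QuotientAddGroup.mk : A → A ⧸ N) ⁻¹' {c}) = μ N := by
  obtain ⟨g, rfl⟩ := QuotientAddGroup.mk_surjective c
  rw [preimage_mk_singleton]
  exact measure_preimage_add μ (-g) (N : Set A)

/-- `|A/N| · μ(N) = μ(A)`: the cosets partition `A`. -/
theorem card_mul_measure_eq [Fintype (A ⧸ N)] (hN : MeasurableSet (N : Set A)) :
    (Fintype.card (A ⧸ N) : ENNReal) * μ N = μ Set.univ := by
  have h := sum_measure_preimage_singleton (μ := μ) (Finset.univ : Finset (A ⧸ N))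
    (fun c _ => measurableSet_fiber N hN c)
  simp only [measure_fiber μ N, Finset.sum_const, Finset.card_univ, nsmul_eq_mul, Finset.coe_univ,
    Set.preimage_univ] at h
  exact h

/-- For a probability measure, `μ(N) = |A/N|⁻¹`. -/
theorem measure_addSubgroup_eq_inv_card [IsProbabilityMeasure μ] [Fintype (A ⧸ N)]
    (hN : MeasurableSet (N : Set A)) : μ N = (Fintype.card (A ⧸ N) : ENNReal)⁻¹ := by
  have h := card_mul_measure_eq μ N hN
  rw [measure_univ] at h
  have hc : (Fintype.card (A ⧸ N) : ENNReal) ≠ 0 := by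
    exact_mod_cast Fintype.card_ne_zero
  calc μ N = ((Fintype.card (A ⧸ N) : ENNReal)⁻¹ * Fintype.card (A ⧸ N)) * μ N := by
        rw [ENNReal.inv_mul_cancel hc (ENNReal.natCast_ne_top _), one_mul]
    _ = (Fintype.card (A ⧸ N) : ENNReal)⁻¹ := by rw [mul_assoc, h, mul_one]

omit [MeasurableSpace A] [MeasurableAdd A] [μ.IsAddLeftInvariant] in
/-- A function of the class modulo `N` is the sum of its constant values times the indicators of the
fibres. -/
theorem comp_mk_eq_sum_indicator [Fintype (A ⧸ N)] (f : A ⧸ N → ℂ) (x : A) :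
    f (QuotientAddGroup.mk x) = ∑ c : A ⧸ N,
      ((QuotientAddGroup.mk : A → A ⧸ N) ⁻¹' {c}).indicator (fun _ => f c) x := by
  rw [Finset.sum_eq_single (QuotientAddGroup.mk x : A ⧸ N)]
  · rw [Set.indicator_of_mem (Set.mem_preimage.2 (Set.mem_singleton _))]
  · intro b _ hb
    refine Set.indicator_of_notMem (fun h => hb ?_) _
    exact (Set.mem_singleton_iff.1 (Set.mem_preimage.1 h)).symm
  · intro h
    exact absurd (Finset.mem_univ _) h

/-- **Coset average.** For a left-invariant probability measure `μ` on `A` and a measurable subgroup `N`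
of finite index, a function of the class modulo `N` integrates to its average over `A ⧸ N`. -/
theorem integral_comp_mk [IsProbabilityMeasure μ] [Fintype (A ⧸ N)] (hN : MeasurableSet (N : Set A))
    (f : A ⧸ N → ℂ) :
    ∫ x, f (QuotientAddGroup.mk x) ∂μ = (Fintype.card (A ⧸ N) : ℂ)⁻¹ * ∑ c, f c := by
  classical
  simp_rw [comp_mk_eq_sum_indicator N f]
  rw [integral_finsetSum _ (fun c _ => (integrable_const (f c)).indicator (measurableSet_fiber N hN c))]
  rw [Finset.mul_sum]
  refine Finset.sum_congr rfl (fun c _ => ?_)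
  rw [integral_indicator_const _ (measurableSet_fiber N hN c), measureReal_def, measure_fiber,
    measure_addSubgroup_eq_inv_card μ N hN, ENNReal.toReal_inv, ENNReal.toReal_natCast,
    Complex.real_smul, Complex.ofReal_inv, Complex.ofReal_natCast]

end AddGroup

/-! ### The quotient ring `𝒪 ⧸ I` and the Gauss sum -/

section Ring

variable {𝒪 : Type*} [CommRing 𝒪] [MeasurableSpace 𝒪] [MeasurableAdd 𝒪] (μ : Measure 𝒪)
  [μ.IsAddLeftInvariant] [IsProbabilityMeasure μ] (I : Ideal 𝒪) [Fintype (𝒪 ⧸ I)]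

/-- The coset average for the quotient ring `𝒪 ⧸ I` (`𝒪 ⧸ I` is by definition the quotient of the
additive group `𝒪` by `I`). -/
theorem integral_comp_quotientMk (hI : MeasurableSet (I : Set 𝒪)) (f : 𝒪 ⧸ I → ℂ) :
    ∫ x, f (Ideal.Quotient.mk I x) ∂μ = (Fintype.card (𝒪 ⧸ I) : ℂ)⁻¹ * ∑ c, f c := by
  letI : Fintype (𝒪 ⧸ I.toAddSubgroup) := inferInstanceAs (Fintype (𝒪 ⧸ I))
  exact integral_comp_mk μ I.toAddSubgroup hI f

/-- **Kudla's integral is the finite Gauss sum**: `∫_𝒪 χ(π y) ψ(π y) dμ(y) = |𝒪/I|⁻¹ · gaussSum χ ψ`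
(the multiplicative character `χ` of `𝒪/I` vanishes on the non-units, so the integrand is the indicator of
`{y ∣ π y ∈ (𝒪/I)^×}` times a function of the class of `y`). -/
theorem integral_mulChar_mul_addChar (hI : MeasurableSet (I : Set 𝒪)) (χ : MulChar (𝒪 ⧸ I) ℂ)
    (ψ : AddChar (𝒪 ⧸ I) ℂ) :
    ∫ y, χ (Ideal.Quotient.mk I y) * ψ (Ideal.Quotient.mk I y) ∂μ
      = (Fintype.card (𝒪 ⧸ I) : ℂ)⁻¹ * gaussSum χ ψ :=
  integral_comp_quotientMk μ I hI (fun c => χ c * ψ c)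

omit [MeasurableAdd 𝒪] [μ.IsAddLeftInvariant] [IsProbabilityMeasure μ] [Fintype (𝒪 ⧸ I)] in
/-- The integrand vanishes off `{y ∣ π y ∈ (𝒪/I)^×}`, so the integral over that set (Kudla's `∫_{𝒪^×}`)
is the integral over `𝒪`. -/
theorem setIntegral_units_eq_integral (χ : MulChar (𝒪 ⧸ I) ℂ) (ψ : AddChar (𝒪 ⧸ I) ℂ) :
    ∫ y in {y : 𝒪 | IsUnit (Ideal.Quotient.mk I y)},
        χ (Ideal.Quotient.mk I y) * ψ (Ideal.Quotient.mk I y) ∂μ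
      = ∫ y, χ (Ideal.Quotient.mk I y) * ψ (Ideal.Quotient.mk I y) ∂μ := by
  refine setIntegral_eq_integral_of_forall_compl_eq_zero (fun y hy => ?_)
  rw [Set.mem_setOf_eq] at hy
  rw [MulChar.map_nonunit χ hy, zero_mul]

/-- **Kudla's `𝔤` is the normalised Gauss sum**: `√|𝒪/I| · ∫_𝒪 χ(π y) ψ(π y) dμ = gNorm χ ψ`
(`= |𝒪/I|^{-1/2} · gaussSum χ ψ`): the factor `q^{c/2}` of `𝔤(ω,ψ) = q^{c/2} ∫_{𝒪^×} ω^{-1}(y) ψ(ϖ^{-c}y) dy`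
for `|𝒪/𝔭^c| = q^c`. -/
theorem sqrt_card_mul_integral_eq_gNorm (hI : MeasurableSet (I : Set 𝒪)) (χ : MulChar (𝒪 ⧸ I) ℂ)
    (ψ : AddChar (𝒪 ⧸ I) ℂ) :
    ((Real.sqrt (Fintype.card (𝒪 ⧸ I)) : ℝ) : ℂ)
        * ∫ y, χ (Ideal.Quotient.mk I y) * ψ (Ideal.Quotient.mk I y) ∂μ
      = gNorm χ ψ := by
  rw [integral_mulChar_mul_addChar μ I hI, gNorm]
  have hs : ((Real.sqrt (Fintype.card (𝒪 ⧸ I)) : ℝ) : ℂ) * ((Real.sqrt (Fintype.card (𝒪 ⧸ I)) : ℝ) : ℂ)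
      = (Fintype.card (𝒪 ⧸ I) : ℂ) := by
    rw [← Complex.ofReal_mul, Real.mul_self_sqrt (Nat.cast_nonneg _), Complex.ofReal_natCast]
  have hne : ((Real.sqrt (Fintype.card (𝒪 ⧸ I)) : ℝ) : ℂ) ≠ 0 := by
    rw [Ne, Complex.ofReal_eq_zero, Real.sqrt_eq_zero', not_le]
    exact_mod_cast Fintype.card_pos
  rw [← hs, mul_inv, ← mul_assoc, ← mul_assoc, mul_inv_cancel₀ hne, one_mul]

end Ring

end Summit.Ventures.HodgeRepro2.T5HaarCosetAverage
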